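import Literature.AlgebraicGeometry.Motives.HodgeThetaSubalgebraSymplecticRankEight
import Literature.AlgebraicGeometry.Motives.HodgeThetaSubalgebraSymplecticRankTenHodge
import HarnessLib

/-!
# `Lie Hg = 𝔰𝔭₈` or the Mumford position, for a weight-one polarized Hodge structure of rank `8` with `End_Hdg = ℚ`
# (Moonen–Zarhin 1999 Thm. (0.1)(3), (2.5)(1): simple abelian fourfolds with `End⁰ = ℚ`; Mumford 1969 §4)

Topic `Literature/AlgebraicGeometry/Motives` (namespace `Literature.AlgebraicGeometry.Motives.HodgeStructure`).  Theorems only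
(no definition, no named fact; D-0026).  Written for the cell `pub-hodge-ring2` (literature lane gen 72, programme R49; honest
framing of that cell: research route conditional on HC_CM; not a corollary; Q11.4-sentence-2 already refuted in dim ≥ 3 — THIS
file is unconditional Hodge–Lie theory).  Sequel of `HodgeThetaSubalgebraSymplecticRankEight` (`SymplecticThetaEight.dichotomy`),
`HodgeLieWeightOnePlusPairTwinIdeal` / `…SpanBranch` (the twin ideal of the plus pair) and the rank-ten chain
`HodgeLieWeightOneRankTenSymplectic` → `…RankTenSkew` → `…RankTenHodge` whose §§2–3 are here made RANK-GENERIC by taking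
«`Lie Hg ⊗ ℂ ∋` every `ψ_ℂ`-skew operator» as a HYPOTHESIS (it is a theorem in ranks `4, 6, 10`; in rank `8` it is one branch
of the dichotomy).

* §1 (any rank) **`mem_spanC_of_skew_of_hodgeLieC`** — if `(Lie Hg)_ℂ = 𝔰𝔭(V,ψ)_ℂ` then EVERY rational bracket-closed
  `𝔤 ⊆ 𝔰𝔭(V,ψ)` with `Θ ∈ 𝔤_ℂ` has `𝔤_ℂ = 𝔰𝔭(V,ψ)_ℂ` (Deligne rigidity `hodgeLie_rigid`); **`wordDerAt_eq_zero_of_skew_of_hodgeLieC`**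
  — Theorem L-Sp: a rational coefficient tensor killed by `Θ` is killed by every `ψ_ℂ`-skew operator.
* §2 (rank eight) **`hodgeLieC_rankEight_dichotomy`** — for `H` effective polarized of weight `1`, `dim_ℚ V = 8`,
  `End_Hdg(V) = ℚ`: EITHER `Lie Hg ⊗ ℂ ∋` every `ψ_ℂ`-skew operator («`Hg(X) = Sp(V,φ) ≅ Sp_{8,ℚ}`»), OR `Lie Hg ⊗ ℂ` is in
  the MUMFORD position: a plus pair `B₀, B̄₀` spanning the raising/lowering lines with `B₀B̄₀ = μ₀ ≠ 0` on `V^{1,0}`, and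
  `Lie Hg ⊗ ℂ = W ⊕ C` with a three-dimensional ideal `W` commuting with `C ⊇ 𝔰 = ⟨B₀, B̄₀, Θ⟩ ≅ 𝔰𝔩₂` («or `Hg(X)` is a
  `ℚ`-form of an almost direct product of three copies of `SL₂`» — Mumford's examples show this branch is not empty; the
  parity obstruction `four_dvd_finrank_of_twin` of rank ten is void since `4 ∣ 8`).
* §3 (any rank) **`not_forall_skew_mem_hodgeLieC_of_raisingLine`** — the two branches EXCLUDE each other: a raising LINE
  `ℂ B₀` with `B₀ B̄₀ = μ₀ ≠ 0` on `V^{1,0}`, `dim V^{1,0} ≥ 2`, is incompatible with `Hg = Sp` (the rank-one skew raising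
  operators `v ↦ ψ_ℂ(u, v) u`, `u ∈ V^{1,0}`).

## References

* [MoonenZarhin1999LowDim] B. Moonen, Yu. Zarhin, Math. Ann. 315 (1999), Thm. (0.1)(3); §2 (2.3), (2.5)(1)
  [corpus: paper:arxiv-math_9901113 p0001 L112–118, p0005 L142–148].
* [MoonenZarhin1995Duke] B. Moonen, Yu. Zarhin, Duke Math. J. 77 (1995), §2 and main theorem, type I(1) [acq-04933 cite-only].
* [Mumford1969NoteShimura] D. Mumford, *A note of Shimura's paper …*, Math. Ann. 181 (1969), §4.
* [Deligne1982HodgeCycles] P. Deligne, *Hodge cycles on abelian varieties*, LNM 900 (1982), I §3 Prop. 3.4, 3.6.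
* [Milne1999LefschetzClasses] J. S. Milne, *Lefschetz classes on abelian varieties*, Duke Math. J. 96 (1999), Prop. 3.6 (a).
* [Jacobson1962LieAlgebras] N. Jacobson, *Lie Algebras* (1962), Ch. X §1 (simple ideals under base change).
-/

open scoped TensorProduct

namespace Literature.AlgebraicGeometry.Motives

open Module

universe u

variable {V : Type u} [AddCommGroup V] [Module ℚ V] [Module.Finite ℚ V] [HodgeTensorFacts.{u, u}] {n : ℤ}

namespace HodgeStructure

/-! ## §1 Rank-generic: `(Lie Hg)_ℂ = 𝔰𝔭` propagates to every admissible `𝔤`, and Theorem L-Sp -/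

/-- **If `(Lie Hg)_ℂ = 𝔰𝔭(V,ψ)_ℂ` then every admissible `𝔤` has `𝔤_ℂ = 𝔰𝔭(V,ψ)_ℂ`** (any rank): for `𝔤 ⊆ 𝔰𝔭(V, ψ)` rational,
bracket-closed, with `Θ ∈ 𝔤_ℂ`, every `ψ_ℂ`-skew operator of `V_ℂ` lies in `𝔤_ℂ`.  PROOF: `𝔞 := 𝔤 ∩ Lie Hg(H)` is bracket-closed
and `Θ ∈ 𝔞_ℂ` (`spanC_inf_eq`, `mem_hodgeLieC_of_forall_piece`); Deligne's rigidity (`hodgeLie_rigid`) gives `Lie Hg ≤ 𝔞 ≤ 𝔤`.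
[cite: Deligne1982HodgeCycles, I §3 Prop. 3.4] [cite: MoonenZarhin1999LowDim, §2 (2.3) and §1 (1.8)] -/
theorem mem_spanC_of_skew_of_hodgeLieC (H : HodgeStructure V n) (ψ : H.Polarization)
    (hsp : ∀ Y : Module.End ℂ (ℂ ⊗[ℚ] V),
      (∀ x y, ψ.form.baseChange ℂ (Y x) y + ψ.form.baseChange ℂ x (Y y) = 0) → Y ∈ H.hodgeLieC)
    (𝔤 : Submodule ℚ (Module.End ℚ V)) (hbr : ∀ X ∈ 𝔤, ∀ X' ∈ 𝔤, X * X' - X' * X ∈ 𝔤)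
    {Θ : Module.End ℂ (ℂ ⊗[ℚ] V)} (hΘ : ∀ p, ∀ x ∈ H.piece p (n - p), Θ x = ((2 * p - n : ℤ) : ℂ) • x)
    (hΘ𝔤 : Θ ∈ spanC 𝔤) {Y : Module.End ℂ (ℂ ⊗[ℚ] V)}
    (hY : ∀ x y, ψ.form.baseChange ℂ (Y x) y + ψ.form.baseChange ℂ x (Y y) = 0) : Y ∈ spanC 𝔤 := by
  have hΘ𝔥 : Θ ∈ spanC H.hodgeLie := (hodgeLieC_eq_spanC H) ▸ H.mem_hodgeLieC_of_forall_piece hΘ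
  have hΘ𝔞 : Θ ∈ spanC (𝔤 ⊓ H.hodgeLie) := by rw [spanC_inf_eq]; exact ⟨hΘ𝔤, hΘ𝔥⟩
  have hbr𝔞 : ∀ X ∈ 𝔤 ⊓ H.hodgeLie, ∀ X' ∈ 𝔤 ⊓ H.hodgeLie, X * X' - X' * X ∈ 𝔤 ⊓ H.hodgeLie :=
    fun X hX X' hX' => ⟨hbr X hX.1 X' hX'.1, H.commutator_mem_hodgeLie hX.2 hX'.2⟩
  have h𝔥le : H.hodgeLie ≤ 𝔤 ⊓ H.hodgeLie := hodgeLie_rigid H ⟨ψ⟩ (𝔤 ⊓ H.hodgeLie) inf_le_right hbr𝔞 ⟨Θ, hΘ𝔞, hΘ⟩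
  have hY𝔥 : Y ∈ H.hodgeLieC := hsp Y hY
  rw [hodgeLieC_eq_spanC] at hY𝔥
  exact spanC_mono (h𝔥le.trans inf_le_left) hY𝔥

section AnnLie

open Literature.RepresentationTheory.GeneralLinear Literature.NumberTheory.DiophantineGeometry

variable {M N k : ℕ}

/-- **Theorem L-Sp under `(Lie Hg)_ℂ = 𝔰𝔭` (invariance of rational tensors under `𝔰𝔭(V_ℂ, ψ_ℂ)`; any rank).** Let `q` be a
rational coefficient tensor (letters: slots `Fin k` × a `ℚ`-basis `eQ` of `V`) killed — slice by slice, diagonally — by the matrix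
of the Hodge operator `Θ`. Then `q` is killed by the matrix of EVERY `ψ_ℂ`-skew operator `Y` of `V_ℂ`: the rational Lie algebra
`𝔞 ⊆ 𝔰𝔭(V, ψ)` of operators killing `q` (`annLie`) is bracket-closed with `Θ ∈ 𝔞_ℂ` by descent (`mem_spanC_annLie`), so
`𝔞_ℂ ∋ Y` by `mem_spanC_of_skew_of_hodgeLieC`. (MZ99 (1.8): «`Hg(X) = Sp_D(V,φ)` ⟺ … `D(Xⁿ) = B(Xⁿ)` for all `n`»; the
passage to divisor classes is Milne 1999 Prop. 3.6 (a).) [cite: MoonenZarhin1999LowDim, §1 (1.8) and §2 p. 715]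
[cite: Deligne1982HodgeCycles, I §3 (proof of Prop. 3.4)] [cite: Milne1999LefschetzClasses, Prop. 3.6 (a)] -/
theorem wordDerAt_eq_zero_of_skew_of_hodgeLieC (H : HodgeStructure V n) (ψ : H.Polarization)
    (hsp : ∀ Y : Module.End ℂ (ℂ ⊗[ℚ] V),
      (∀ x y, ψ.form.baseChange ℂ (Y x) y + ψ.form.baseChange ℂ x (Y y) = 0) → Y ∈ H.hodgeLieC)
    (eQ : Module.Basis (Fin M) ℚ V) (q : (Fin N → Fin k × Fin M) → ℚ) {Θ : Module.End ℂ (ℂ ⊗[ℚ] V)}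
    (hΘ : ∀ p, ∀ x ∈ H.piece p (n - p), Θ x = ((2 * p - n : ℤ) : ℂ) • x)
    (hΘq : ∀ u : Fin N → Fin k, wordDerAt ℂ (fun _ : Fin N =>
      LinearMap.toMatrix (Algebra.TensorProduct.basis ℂ eQ) (Algebra.TensorProduct.basis ℂ eQ) Θ)
      (wordSlice (fun w => algebraMap ℚ ℂ (q w)) u) = 0)
    {Y : Module.End ℂ (ℂ ⊗[ℚ] V)}
    (hYskew : ∀ x y, ψ.form.baseChange ℂ (Y x) y + ψ.form.baseChange ℂ x (Y y) = 0) (u : Fin N → Fin k) :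
    wordDerAt ℂ (fun _ : Fin N =>
      LinearMap.toMatrix (Algebra.TensorProduct.basis ℂ eQ) (Algebra.TensorProduct.basis ℂ eQ) Y)
      (wordSlice (fun w => algebraMap ℚ ℂ (q w)) u) = 0 := by
  set 𝔞 : Submodule ℚ (Module.End ℚ V) := annLie ψ.form eQ (fun a : H.endAlg => (a : Module.End ℚ V)) q
    with h𝔞
  have hΘC : Θ ∈ H.hodgeLieC := H.mem_hodgeLieC_of_forall_piece hΘ
  have hΘ𝔞 : Θ ∈ spanC 𝔞 :=
    mem_spanC_annLie ψ.form eQ _ q hΘq (fun a => commute_baseChange_of_mem_hodgeLieC H hΘC a)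
      fun x y => by rw [formBaseChange_skew_of_mem_hodgeLieC ψ hΘC, neg_add_cancel]
  have hbr : ∀ X ∈ 𝔞, ∀ X' ∈ 𝔞, X * X' - X' * X ∈ 𝔞 := fun X hX X' hX' =>
    commutator_mem_annLie ψ.form eQ _ q hX hX'
  have hY : Y ∈ spanC 𝔞 := mem_spanC_of_skew_of_hodgeLieC H ψ hsp 𝔞 hbr hΘ hΘ𝔞 hYskew
  rw [h𝔞] at hY
  exact wordDerAt_eq_zero_of_mem_spanC_annLie ψ.form eQ _ q hY u

end AnnLie

/-! ## §2 Rank eight: `𝔰𝔭₈` or the Mumford position -/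

set_option maxHeartbeats 800000 in
/-- **`Lie Hg(H) ⊗ ℂ = 𝔰𝔭₈`, OR the Mumford position**, for `H` effective polarized of weight `1`, `dim_ℚ V = 8`,
`End_Hdg(V) = ℚ`.  By `SymplecticThetaEight.dichotomy` (for `𝔤 = Lie Hg`, admissible by `hodgeLie_standing`) either every
`ψ_ℂ`-skew operator is in `𝔥_ℂ` («`Hg(X) = Sp(V,φ) ≅ Sp_{8,ℚ}`»), or `𝔥_ℂ` is in the plus-pair position; then `𝔷 = 0`
(`hodgeLie_inf_endAlg_eq_bot_of_forall_endAlg_eq_smul`) and `exists_twin_ideal_of_plusPair` gives `𝔥_ℂ = W ⊕ C` with a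
three-dimensional ideal `W` commuting with `C` and with `𝔰 = ⟨B₀, B̄₀, Θ⟩` — the case `𝔥_ℂ ≤ 𝔰` being absurd since it forces
`End_ℂ(V^{1,0}) = ℂ` (`forall_end_piece_eq_smul_of_hodgeLieC_le_span`) while `dim V^{1,0} = 4` («or `Hg(X)` is a `ℚ`-form of an
almost direct product of three copies of `SL₂`»). [cite: MoonenZarhin1999LowDim, Thm. (0.1)(3) and §2 (2.5)(1)]
[cite: MoonenZarhin1995Duke, §2 (type I(1))] [cite: Mumford1969NoteShimura, §4] [cite: Jacobson1962LieAlgebras, Ch. X §1]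
[cite: Deligne1982HodgeCycles, I §3 Prop. 3.4 and Prop. 3.6] -/
theorem hodgeLieC_rankEight_dichotomy (H : HodgeStructure V n) (hn : n = 1) (heff : H.IsEffective) (ψ : H.Polarization)
    (hE : ∀ a ∈ H.endAlg, ∃ x : ℚ, a = x • (1 : Module.End ℚ V)) (hV : Module.finrank ℚ V = 8) :
    (∀ Y : Module.End ℂ (ℂ ⊗[ℚ] V),
      (∀ x y, ψ.form.baseChange ℂ (Y x) y + ψ.form.baseChange ℂ x (Y y) = 0) → Y ∈ H.hodgeLieC) ∨
    ∃ Θ B₀ C₀ : Module.End ℂ (ℂ ⊗[ℚ] V), ∃ μ₀ : ℂ,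
      (∀ p, ∀ x ∈ H.piece p (n - p), Θ x = ((2 * p - n : ℤ) : ℂ) • x) ∧ Θ ∈ H.hodgeLieC ∧
      B₀ ∈ H.hodgeLieC ∧ C₀ ∈ H.hodgeLieC ∧ B₀ ≠ 0 ∧
      (∀ p ∈ H.piece 1 0, B₀ p = 0) ∧ (∀ v, B₀ v ∈ H.piece 1 0) ∧ (∀ v, C₀ v = conj (B₀ (conj v))) ∧
      (∀ q ∈ H.piece 0 1, C₀ q = 0) ∧ (∀ v, C₀ v ∈ H.piece 0 1) ∧ μ₀ ≠ 0 ∧ starRingEnd ℂ μ₀ = μ₀ ∧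
      (∀ p ∈ H.piece 1 0, B₀ (C₀ p) = μ₀ • p) ∧ (∀ q ∈ H.piece 0 1, C₀ (B₀ q) = μ₀ • q) ∧
      (∀ B ∈ H.hodgeLieC, (∀ p ∈ H.piece 1 0, B p = 0) → (∀ v, B v ∈ H.piece 1 0) → ∃ c : ℂ, B = c • B₀) ∧
      (∀ C ∈ H.hodgeLieC, (∀ q ∈ H.piece 0 1, C q = 0) → (∀ v, C v ∈ H.piece 0 1) → ∃ c : ℂ, C = c • C₀) ∧
      ∃ W C : Submodule ℂ (Module.End ℂ (ℂ ⊗[ℚ] V)), W ≤ H.hodgeLieC ∧ C ≤ H.hodgeLieC ∧ W ⊓ C = ⊥ ∧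
        W ⊔ C = H.hodgeLieC ∧ Module.finrank ℂ W = 3 ∧
        (∀ Y ∈ H.hodgeLieC, ∀ w ∈ W, Y * w - w * Y ∈ W) ∧ (∀ Y ∈ H.hodgeLieC, ∀ c ∈ C, Y * c - c * Y ∈ C) ∧
        (∀ w ∈ W, ∀ c ∈ C, w * c = c * w) ∧
        (∀ w ∈ W, ∀ s ∈ Submodule.span ℂ (Set.range ![B₀, C₀, Θ]), w * s = s * w) := by
  classical
  obtain ⟨hbr, hskew, -, Θ, hΘ, hΘ𝔤⟩ := hodgeLie_standing H ψ
  rcases SymplecticThetaEight.dichotomy H hn heff ψ hE hV H.hodgeLie hbr hΘ hΘ𝔤 hskew with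
    hall | ⟨B₀, hB₀, C₀, hC₀𝔤, μ₀, hB₀0, hB₀P, hB₀im, hC₀, hC₀Q, hC₀im, hμ₀, hμ₀r, hBC, hCB, hline, hline'⟩
  · left
    intro Y hY
    rw [hodgeLieC_eq_spanC]
    exact hall Y hY
  · right
    rw [← hodgeLieC_eq_spanC] at hB₀ hC₀𝔤 hΘ𝔤 hline hline'
    have hz := hodgeLie_inf_endAlg_eq_bot_of_forall_endAlg_eq_smul H ψ hE
    rcases exists_twin_ideal_of_plusPair H ψ hn heff hΘ hB₀ hB₀0 hB₀P hB₀im hC₀ hμ₀ hBC hCB hline hline' hz with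
      hle | ⟨W, C, hWle, hCle, hWC0, hWC, hW3, hWst, hCst, hcommWC, hW𝔰⟩
    · -- `𝔥_ℂ ≤ ⟨B₀, C₀, Θ⟩`: `End(V^{1,0})` would be `ℂ`, but `dim V^{1,0} = 4`
      exfalso
      have hscal := forall_end_piece_eq_smul_of_hodgeLieC_le_span H hn heff hΘ hB₀P hB₀im hC₀ hμ₀ hBC hCB hle hE
      have hP4 := (SymplecticThetaEight.finrank_pieces_eq_four H hn heff hV hΘ).1
      let b := Module.finBasisOfFinrankEq ℂ (H.piece 1 0) hP4
      obtain ⟨c, hc⟩ := hscal ((b.coord 1).smulRight (b 0))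
      have h1 := LinearMap.congr_fun hc (b 1)
      rw [LinearMap.smulRight_apply, Module.Basis.coord_apply, b.repr_self, Finsupp.single_eq_same, one_smul,
        LinearMap.smul_apply, Module.End.one_apply] at h1
      have h2 : (b.repr (b 0)) 0 = (b.repr (c • b 1)) 0 := by rw [h1]
      rw [b.repr_self, Finsupp.single_eq_same, map_smul, Finsupp.smul_apply, b.repr_self, Finsupp.single_apply,
        if_neg (by decide), smul_zero] at h2
      exact one_ne_zero h2
    · exact ⟨Θ, B₀, C₀, μ₀, hΘ, hΘ𝔤, hB₀, hC₀𝔤, hB₀0, hB₀P, hB₀im, hC₀, hC₀Q, hC₀im, hμ₀, hμ₀r, hBC, hCB, hline, hline',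
        W, C, hWle, hCle, hWC0, hWC, hW3, hWst, hCst, hcommWC, hW𝔰⟩

/-! ## §3 Exclusivity: in the plus-line (Mumford) position not every `ψ_ℂ`-skew operator is in `𝔥_ℂ` -/

/-- **The two branches of `hodgeLieC_rankEight_dichotomy` EXCLUDE each other** (rank-generic form). If the raising
operators of `𝔥_ℂ = Lie Hg ⊗ ℂ` lie on a LINE `ℂ B₀` whose generator satisfies `B₀ C₀ = μ₀ ≠ 0` on `V^{1,0}` for some
`C₀` (so `B₀` maps onto `V^{1,0}`), and `dim V^{1,0} ≥ 2`, then some `ψ_ℂ`-skew operator is NOT in `𝔥_ℂ`: for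
`u ∈ V^{1,0}`, `u ≠ 0`, the rank-one operator `Y_u v = ψ_ℂ(u, v) u` is `ψ_ℂ`-skew (`ψ_ℂ` is alternating in weight one),
raising (`V^{1,0}` is `ψ_ℂ`-isotropic) and non-zero (`ψ_ℂ` is nondegenerate), whereas every non-zero multiple of `B₀` has
all of `V^{1,0}` in its range. In particular a weight-one Hodge structure in the MUMFORD POSITION (rank 8: `Hg` a
`ℚ`-form of `SL₂ × SL₂ × SL₂`, «in which case there are exceptional Hodge classes in `B²(X²)`») does not have `Hg = Sp`.
[cite: MoonenZarhin1999LowDim, Thm. (0.1)(3) and §2 (2.5)(1)] [cite: Mumford1969NoteShimura, §4] -/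
theorem not_forall_skew_mem_hodgeLieC_of_raisingLine (H : HodgeStructure V n) (hn : n = 1) (ψ : H.Polarization)
    {B₀ C₀ : Module.End ℂ (ℂ ⊗[ℚ] V)} {μ₀ : ℂ} (hμ₀ : μ₀ ≠ 0)
    (hBC : ∀ p ∈ H.piece 1 0, B₀ (C₀ p) = μ₀ • p)
    (hline : ∀ B ∈ H.hodgeLieC, (∀ p ∈ H.piece 1 0, B p = 0) → (∀ v, B v ∈ H.piece 1 0) → ∃ c : ℂ, B = c • B₀)
    (hP2 : 2 ≤ Module.finrank ℂ (H.piece 1 0)) :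
    ¬ ∀ Y : Module.End ℂ (ℂ ⊗[ℚ] V),
      (∀ x y, ψ.form.baseChange ℂ (Y x) y + ψ.form.baseChange ℂ x (Y y) = 0) → Y ∈ H.hodgeLieC := by
  classical
  subst hn
  intro hsp
  set P := H.piece 1 0 with hPdef
  set ω := ψ.form.baseChange ℂ with hω
  have hωnd : ω.Nondegenerate := ψ.nondegenerate_baseChange
  have hωalt : ∀ a b, ω a b = -ω b a := fun a b => by
    rw [hω, ψ.form_baseChange_swap b a, Int.negOnePow_odd 1 odd_one]
    norm_num
  have hPP : ∀ p ∈ P, ∀ p' ∈ P, ω p p' = 0 := fun p hp p' hp' =>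
    ψ.form_piece_piece (p := 1) (p' := 1) (by norm_num) (by rw [show (1 : ℤ) - 1 = 0 by norm_num]; exact hp)
      (by rw [show (1 : ℤ) - 1 = 0 by norm_num]; exact hp')
  -- a non-zero vector `u` of `P` (`dim P ≥ 2 > 0`)
  obtain ⟨u, huP, hu0⟩ : ∃ u ∈ P, u ≠ 0 := by
    by_contra h
    push Not at h
    have hbot : P = ⊥ := (Submodule.eq_bot_iff P).2 h
    rw [hbot, finrank_bot] at hP2
    omega
  -- the rank-one operator `Y v = ω(u, v) u`: skew, raising, non-zero
  set Y : Module.End ℂ (ℂ ⊗[ℚ] V) := (ω u).smulRight u with hYdef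
  have hYapply : ∀ v, Y v = ω u v • u := fun v => by rw [hYdef, LinearMap.smulRight_apply]
  have hYskew : ∀ x y, ω (Y x) y + ω x (Y y) = 0 := by
    intro x y
    rw [hYapply, hYapply, map_smul, LinearMap.smul_apply, map_smul, smul_eq_mul, smul_eq_mul, hωalt x u]
    ring
  have hY𝔥 : Y ∈ H.hodgeLieC := hsp Y hYskew
  have hYP : ∀ p ∈ P, Y p = 0 := fun p hp => by rw [hYapply, hPP u huP p hp, zero_smul]
  have hYim : ∀ v, Y v ∈ P := fun v => by
    rw [hYapply]
    exact P.smul_mem _ huP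
  obtain ⟨v, hv⟩ : ∃ v, ω u v ≠ 0 := by
    by_contra h
    push Not at h
    exact hu0 (hωnd.1 u h)
  -- `Y = c • B₀` with `c ≠ 0`, so `B₀` takes values in the line `ℂ u`
  obtain ⟨c, hc⟩ := hline Y hY𝔥 hYP hYim
  have hc0 : c ≠ 0 := by
    rintro rfl
    rw [zero_smul] at hc
    have h := hYapply v
    rw [hc, LinearMap.zero_apply] at h
    exact hv ((smul_eq_zero.1 h.symm).resolve_right hu0)
  have hB₀ : ∀ x, B₀ x = (c⁻¹ * ω u x) • u := fun x => by
    have h := congrArg (fun T : Module.End ℂ (ℂ ⊗[ℚ] V) => c⁻¹ • T x) hc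
    simp only [LinearMap.smul_apply, smul_smul, inv_mul_cancel₀ hc0, one_smul] at h
    rw [← h, hYapply, smul_smul]
  -- hence `P ≤ ℂ u`: `p = μ₀⁻¹ B₀ (C₀ p)`
  have hle : P ≤ Submodule.span ℂ ({u} : Set (ℂ ⊗[ℚ] V)) := by
    intro p hp
    have h := hBC p hp
    rw [hB₀] at h
    have hp' : p = (μ₀⁻¹ * (c⁻¹ * ω u (C₀ p))) • u := by
      rw [← smul_smul, h, smul_smul, inv_mul_cancel₀ hμ₀, one_smul]
    rw [hp']
    exact Submodule.smul_mem _ _ (Submodule.subset_span rfl)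
  haveI : Module.Finite ℂ (Submodule.span ℂ ({u} : Set (ℂ ⊗[ℚ] V))) :=
    Module.Finite.span_of_finite ℂ (Set.finite_singleton u)
  have h1 := Submodule.finrank_mono hle
  rw [finrank_span_singleton hu0] at h1
  omega

/-- **Rank eight: the MUMFORD POSITION excludes `Hg = Sp`** — `dim V^{1,0} = 4 ≥ 2`
(`SymplecticThetaEight.finrank_pieces_eq_four`) in `not_forall_skew_mem_hodgeLieC_of_raisingLine`; so the two branches
of `hodgeLieC_rankEight_dichotomy` are mutually exclusive. [cite: MoonenZarhin1999LowDim, Thm. (0.1)(3) and §2 (2.5)(1)]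
[cite: Mumford1969NoteShimura, §4] -/
theorem not_forall_skew_mem_hodgeLieC_of_raisingLine_rankEight (H : HodgeStructure V n) (hn : n = 1)
    (heff : H.IsEffective) (ψ : H.Polarization) (hV : Module.finrank ℚ V = 8)
    {B₀ C₀ : Module.End ℂ (ℂ ⊗[ℚ] V)} {μ₀ : ℂ} (hμ₀ : μ₀ ≠ 0)
    (hBC : ∀ p ∈ H.piece 1 0, B₀ (C₀ p) = μ₀ • p)
    (hline : ∀ B ∈ H.hodgeLieC, (∀ p ∈ H.piece 1 0, B p = 0) → (∀ v, B v ∈ H.piece 1 0) → ∃ c : ℂ, B = c • B₀) :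
    ¬ ∀ Y : Module.End ℂ (ℂ ⊗[ℚ] V),
      (∀ x y, ψ.form.baseChange ℂ (Y x) y + ψ.form.baseChange ℂ x (Y y) = 0) → Y ∈ H.hodgeLieC := by
  classical
  obtain ⟨-, -, -, Θ, hΘ, -⟩ := hodgeLie_standing H ψ
  have hP4 := (SymplecticThetaEight.finrank_pieces_eq_four H hn heff hV hΘ).1
  exact not_forall_skew_mem_hodgeLieC_of_raisingLine H hn ψ hμ₀ hBC hline (by rw [hP4]; norm_num)

end HodgeStructure

end Literature.AlgebraicGeometry.Motives
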